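import Summits.QuantumFields.YangMills.Theorems.FluctuationComparisonRegPrIntLS2BetaHybridFourSlot
import Mathlib.Analysis.Complex.Schwarz
import HarnessLib

/-!
# S2β · letter (D♮) REL-TEL, the (C)-half — THE ANALYTIC HALF BY THE CAUCHY ROAD (UV3-NODE §82.3 (R-Cauchy)), FILE 1:
# «SECOND-ORDER BANACH-ALGEBRA LETTERS ARE SIZE-LIPSCHITZ BY THE SCHWARZ LEMMA», AND THE RELATIVE HYBRID ×4 LETTER
# `‖J₁₀(a′,b′,c′,d′,H′) − J₁₀(a,b,c,d,H)‖ ≤ 4096·(e^{32ρ} − 1)·δ` (δ = ANY bound on the sup of the member∕context differences; no closeness needed)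

Cell `ym3-torus` (rung R3 = continuum `SU(2)` Yang–Mills on the three-torus — NOT d = 4, NOT infinite volume, NOT a mass gap, NOT Clay).
Width seat «width 10» `ym3-torus-px10` (gen 23), FREE px helper on crux `stmt-QuantumFields-20520` (`Theses.UnitScaleTilt.FluctuationComparisonRegPrIntL`),
count-neutral, DEFINITION-FREE; own-risk brick of the px10 lane «(C)-half of letter (D♮)» (bus OFFER 12:04:18Z; UV3-NODE §82.3: the analytic junk of the
(C)-STEP ✓`…S2BetaOneLevelStep` — ✓G10 `norm_mlog_word4_sub_mean4_le` + ✓G14 — is an ABSOLUTE second-order bound `≤ C·ρ·(fluctuation)`; the RELATIVE (C)-step of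
letter (D♮) needs its `O(ρ)`-LIPSCHITZ edition in the member logarithms, so that the junk vanishes at `U = U₀`).

THE DEVICE (§1, generic).  Mathlib's Schwarz lemma for maps between complex normed spaces (`Complex.dist_le_div_mul_dist_of_mapsTo_ball`): a map `J : E → F`
complex-differentiable on the ball `B(a₀, r)` and bounded there by `M` moves by at most `(2M∕r)·‖a₁ − a₀‖` between the centre and any point of the ball
(★★ `norm_sub_le_of_norm_le_on_ball`; centred edition `norm_sub_le_of_norm_sub_le_on_ball`; two-point edition on the half ball ★★★ `norm_sub_le_on_half_ball`).  For a
letter whose absolute bound is of SECOND ORDER — `M(R) = C·R²` on the ball of radius `R` about the IDENTITY tuple — `4M(R)∕R = O(R)`: THE LIPSCHITZ CONSTANT IS THE SIZE,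
for free, against the SUP of the differences (the local relative datum the `hj` count of ✓`…S2BetaBondNeighbourhoodKernel` ∕
✓`…S2BetaNeighbourhoodKernelTorus` tolerates).

THE LETTER (§3).  With `E := (ι → 𝔸)⁴ × 𝔸` (sup norm) and the HYBRID ×4 map of ✓G10 written out VERBATIM,
`J₁₀(a,b,c,d,H) := log(e^{ā}e^{b̄}e^{c̄}e^{d̄}H) − mean⁴_{ijkl} log(e^{a i}e^{b j}e^{c k}e^{d l}H)`:
★★★ `norm_hybrid4_sub_hybrid4_le` — for two member tuples of size `≤ ρ ≤ 1∕800` with contexts `‖H − 1‖, ‖H′ − 1‖ ≤ e^ρ − 1` and ANY `δ` dominating the sup of their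
differences: **`‖J₁₀(a′,…,H′) − J₁₀(a,…,H)‖ ≤ 4096·(e^{32ρ} − 1)·δ`** (`≈ 1.3·10⁵·ρ·δ`) — NO closeness needed: both tuples lie in the half ball about the IDENTITY tuple, where
`J₁₀` is Lipschitz with constant `4M∕R` by the two-point device (★★★ `norm_sub_le_on_half_ball`: Schwarz at every point of the half ball + the mean value inequality on the
convex half ball).  §2 supplies the complex differentiability of `J₁₀` on the ball (`NormedSpace.exp_analytic`, lit ✓`MatrixLog.analyticAt_mlog` inside `‖X − 1‖ < 1`,
products∕means) and the absolute bound on the ball (✓G10 at radius `8ρ`, fluctuations `≤ 16ρ` per slot).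

HONEST SCOPE.  One call of Mathlib's Schwarz lemma + differentiability bookkeeping + ✓G10 on a slightly larger ball; nothing of Bałaban's renormalisation analysis is asserted;
the relative CHAIN-COUPLING letter (✓G14's edition — same device, next file), the relative (C)-step, the relative key lemma, (D♮), (F♮), GAP♯∘ (`stub_uniformFibreGapOrbit`), S2β,
crux 20520 and `YM3TorusSU2` are NOT proved; no registered stub is closed; the Yang–Mills mass gap is NOT proved.  Sorry-free, axioms standard.
References: T. Bałaban, CMP **98** (1985) 17–51 [Balaban1985Averaging] ((21) p.21 «both functions are analytic functions of complex matrices», (26)–(27) p.22);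
CMP **109** (1987) 249–301 [Balaban1987RG1] (§3 (3.15)–(3.17) p.288: the Cauchy-formula device for analytic remainders).
-/

set_option autoImplicit false

noncomputable section

namespace Summit.QuantumFields.YangMills.Theorems.FluctuationComparisonRegPrIntLS2BetaSizeLipschitzByCauchy

open NormedSpace Finset Metric
open scoped BigOperators
open Literature.MathematicalPhysics.QuantumFieldTheory.Balaban1983to89.MatrixLog (mlog analyticAt_mlog)
open Literature.Analysis.Calculus.BCH (norm_mul_sub_one_le_of_le)
open Literature.Analysis.Calculus.ExpDifferential (norm_exp_sub_one_le_exp_norm_sub_one)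
open Summit.QuantumFields.YangMills.Theorems.FluctuationComparisonRegPrIntLS2BetaHybridFourSlot (norm_mlog_word4_sub_mean4_le norm_mean_le
  norm_mean_sub_mean_le norm_prod_sub_one_le₄)

/-! ## §1 The device: bounded holomorphic maps are Lipschitz from the centre of a ball (Schwarz) -/

section Device

variable {E F : Type*} [NormedAddCommGroup E] [NormedSpace ℂ E] [NormedAddCommGroup F] [NormedSpace ℂ F]

/-- ★★ **SIZE-LIPSCHITZ BY CAUCHY (centred edition)**: if `J` is complex-differentiable on the ball `B(a₀, r)` and `‖J a − J a₀‖ ≤ M` there, then for every `a₁` in the ball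
`‖J a₁ − J a₀‖ ≤ (M∕r)·‖a₁ − a₀‖` (Mathlib's Schwarz lemma `Complex.dist_le_div_mul_dist_of_mapsTo_ball` for maps between complex normed spaces). [folklore] -/
theorem norm_sub_le_of_norm_sub_le_on_ball {J : E → F} {a₀ a₁ : E} {r M : ℝ} (hd : DifferentiableOn ℂ J (ball a₀ r))
    (hM : ∀ a ∈ ball a₀ r, ‖J a - J a₀‖ ≤ M) (ha₁ : a₁ ∈ ball a₀ r) :
    ‖J a₁ - J a₀‖ ≤ M / r * ‖a₁ - a₀‖ := by
  have hmaps : Set.MapsTo J (ball a₀ r) (closedBall (J a₀) M) := fun a ha => by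
    rw [mem_closedBall, dist_eq_norm]; exact hM a ha
  have h := Complex.dist_le_div_mul_dist_of_mapsTo_ball hd hmaps ha₁
  rwa [dist_eq_norm, dist_eq_norm] at h

/-- ★★ **SIZE-LIPSCHITZ BY CAUCHY**: if `J` is complex-differentiable on `B(a₀, r)` and `‖J a‖ ≤ M` there, then `‖J a₁ − J a₀‖ ≤ (2M∕r)·‖a₁ − a₀‖` for every `a₁` in the ball —
an ABSOLUTE bound on a ball is a LIPSCHITZ bound from its centre, constant `2·(bound)∕(radius)`. [folklore] -/
theorem norm_sub_le_of_norm_le_on_ball {J : E → F} {a₀ a₁ : E} {r M : ℝ} (hd : DifferentiableOn ℂ J (ball a₀ r))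
    (hM : ∀ a ∈ ball a₀ r, ‖J a‖ ≤ M) (ha₁ : a₁ ∈ ball a₀ r) :
    ‖J a₁ - J a₀‖ ≤ 2 * M / r * ‖a₁ - a₀‖ := by
  have hr : 0 < r := (nonempty_ball (x := a₀)).mp ⟨a₁, ha₁⟩
  have h0 : a₀ ∈ ball a₀ r := mem_ball_self hr
  refine norm_sub_le_of_norm_sub_le_on_ball hd (fun a ha => ?_) ha₁
  calc ‖J a - J a₀‖ ≤ ‖J a‖ + ‖J a₀‖ := norm_sub_le _ _
    _ ≤ M + M := add_le_add (hM a ha) (hM a₀ h0)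
    _ = 2 * M := by ring

/-- ★★★ **SIZE-LIPSCHITZ BY CAUCHY, TWO-POINT EDITION**: if `J` is complex-differentiable on `B(a₀, R)` and `‖J a‖ ≤ M` there, then `J` is `(4M∕R)`-LIPSCHITZ ON THE HALF BALL:
`‖J a₁ − J a₂‖ ≤ (4M∕R)·‖a₁ − a₂‖` for all `a₁, a₂ ∈ B(a₀, R∕2)` — Schwarz at every point of the half ball (`Complex.norm_fderiv_le_div_of_mapsTo_ball` on `B(p, R∕2) ⊆ B(a₀, R)`)
bounds the derivative by `2M∕(R∕2)`, and the mean value inequality on the convex half ball (`Convex.norm_image_sub_le_of_norm_fderiv_le`) integrates it.  NO closeness of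
`a₁, a₂` is needed beyond membership in the half ball. [folklore] -/
theorem norm_sub_le_on_half_ball {J : E → F} {a₀ a₁ a₂ : E} {R M : ℝ} (hd : DifferentiableOn ℂ J (ball a₀ R))
    (hM : ∀ a ∈ ball a₀ R, ‖J a‖ ≤ M) (ha₁ : a₁ ∈ ball a₀ (R / 2)) (ha₂ : a₂ ∈ ball a₀ (R / 2)) :
    ‖J a₁ - J a₂‖ ≤ 4 * M / R * ‖a₁ - a₂‖ := by
  have hR : 0 < R := by
    have h := (nonempty_ball (x := a₀)).mp ⟨a₁, ha₁⟩; linarith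
  -- every point of the half ball carries a ball of radius `R∕2` inside the big ball
  have hsub : ∀ p ∈ ball a₀ (R / 2), ball p (R / 2) ⊆ ball a₀ R := fun p hp x hx => by
    rw [mem_ball] at hp hx ⊢
    calc dist x a₀ ≤ dist x p + dist p a₀ := dist_triangle _ _ _
      _ < R / 2 + R / 2 := add_lt_add hx hp
      _ = R := by ring
  have hderiv : ∀ p ∈ ball a₀ (R / 2), ‖fderiv ℂ J p‖ ≤ 4 * M / R := by
    intro p hp
    have hdp : DifferentiableOn ℂ J (ball p (R / 2)) := hd.mono (hsub p hp)
    have hp0 : p ∈ ball a₀ R := hsub p hp (mem_ball_self (by linarith))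
    have hmaps : Set.MapsTo J (ball p (R / 2)) (closedBall (J p) (2 * M)) := fun x hx => by
      rw [mem_closedBall, dist_eq_norm]
      calc ‖J x - J p‖ ≤ ‖J x‖ + ‖J p‖ := norm_sub_le _ _
        _ ≤ M + M := add_le_add (hM x (hsub p hp hx)) (hM p hp0)
        _ = 2 * M := by ring
    have h := Complex.norm_fderiv_le_div_of_mapsTo_ball hdp hmaps (by linarith)
    calc ‖fderiv ℂ J p‖ ≤ 2 * M / (R / 2) := h
      _ = 4 * M / R := by field_simp; ring
  have hdiffAt : ∀ p ∈ ball a₀ (R / 2), DifferentiableAt ℂ J p := fun p hp =>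
    (hd p (hsub p hp (mem_ball_self (by linarith)))).differentiableAt (isOpen_ball.mem_nhds (hsub p hp (mem_ball_self (by linarith))))
  have h := (convex_ball a₀ (R / 2)).norm_image_sub_le_of_norm_fderiv_le hdiffAt hderiv ha₂ ha₁
  exact h

end Device

/-! ## §2 The hybrid ×4 map on `E = (ι → 𝔸)⁴ × 𝔸`: differentiability on the small ball, sizes on the ball -/

section Hybrid

variable {𝔸 : Type*} [NormedRing 𝔸] [NormedAlgebra ℂ 𝔸] [CompleteSpace 𝔸] [NormOneClass 𝔸]
variable {ι : Type*} [Fintype ι] [Nonempty ι]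

omit [NormedAlgebra ℂ 𝔸] [CompleteSpace 𝔸] [NormOneClass 𝔸] in
/-- Five factors: `‖x y z v H − 1‖ ≤ e^{5ρ} − 1` when the four `‖· − 1‖ ≤ e^ρ − 1` and `‖H − 1‖ ≤ e^ρ − 1`. [folklore] -/
theorem norm_prod_sub_one_le₅ {x y z v H : 𝔸} {ρ : ℝ} (hx : ‖x - 1‖ ≤ Real.exp ρ - 1) (hy : ‖y - 1‖ ≤ Real.exp ρ - 1)
    (hz : ‖z - 1‖ ≤ Real.exp ρ - 1) (hv : ‖v - 1‖ ≤ Real.exp ρ - 1) (hH : ‖H - 1‖ ≤ Real.exp ρ - 1) :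
    ‖x * y * z * v * H - 1‖ ≤ Real.exp (5 * ρ) - 1 := by
  have h := norm_mul_sub_one_le_of_le (norm_prod_sub_one_le₄ hx hy hz hv) hH
  rwa [show 4 * ρ + ρ = 5 * ρ by ring] at h

omit [NormedAlgebra ℂ 𝔸] [CompleteSpace 𝔸] [NormOneClass 𝔸] in
/-- Numerics: `e^{5∕100} − 1 < 1`. [folklore] -/
theorem exp_five_div_sub_one_lt_one {ρ : ℝ} (hρ : ρ ≤ 1 / 100) : Real.exp (5 * ρ) - 1 < 1 := by
  have h1 : Real.exp (5 * ρ) ≤ Real.exp (1 / 4) := Real.exp_le_exp.mpr (by linarith)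
  have h2 : Real.exp (1 / 4) < 2 := by
    have h := Real.exp_bound' (x := (1 / 4 : ℝ)) (by norm_num) (by norm_num) (n := 2) (by norm_num)
    simp only [Finset.sum_range_succ, Finset.sum_range_zero, Nat.factorial, Nat.cast_ofNat] at h
    norm_num at h
    linarith
  linarith

omit [NormOneClass 𝔸] in
/-- Every `log(e^{x}e^{y}e^{z}e^{v}H)` with `‖x‖,‖y‖,‖z‖,‖v‖ ≤ ρ ≤ 1∕100`, `‖H − 1‖ ≤ e^ρ − 1` is taken INSIDE the ball of analyticity of `log`: `‖e^{x}e^{y}e^{z}e^{v}H − 1‖ < 1`.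
[cite: Balaban1985Averaging, (21) p.21] -/
theorem norm_word4_sub_one_lt_one {x y z v H : 𝔸} {ρ : ℝ} (hρ : ρ ≤ 1 / 100) (hx : ‖x‖ ≤ ρ) (hy : ‖y‖ ≤ ρ) (hz : ‖z‖ ≤ ρ) (hv : ‖v‖ ≤ ρ)
    (hH : ‖H - 1‖ ≤ Real.exp ρ - 1) : ‖exp x * exp y * exp z * exp v * H - 1‖ < 1 := by
  -- `‖e^{u} − 1‖ ≤ e^{ρ} − 1` for `‖u‖ ≤ ρ` (lit `norm_exp_sub_one_le_exp_norm_sub_one` + monotonicity; = ✓`NE7GradientCurrency.norm_exp_sub_one_le`, not re-declared)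
  have he : ∀ {u : 𝔸}, ‖u‖ ≤ ρ → ‖exp u - 1‖ ≤ Real.exp ρ - 1 := fun hu =>
    (norm_exp_sub_one_le_exp_norm_sub_one _).trans (by gcongr)
  exact (norm_prod_sub_one_le₅ (he hx) (he hy) (he hz) (he hv) hH).trans_lt (exp_five_div_sub_one_lt_one hρ)

omit [NormOneClass 𝔸] in
/-- `exp : 𝔸 → 𝔸` is complex-differentiable everywhere (Mathlib `NormedSpace.exp_analytic`). [folklore] -/
theorem differentiable_exp : Differentiable ℂ (exp : 𝔸 → 𝔸) := fun x => (NormedSpace.exp_analytic x).differentiableAt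

omit [NormedAlgebra ℂ 𝔸] [CompleteSpace 𝔸] [NormOneClass 𝔸] in
/-- On the SUP ball of radius `r` about a tuple `p₀ = (a,b,c,d,H)` of member size `≤ ρ` and context `‖H − 1‖ ≤ e^ρ − 1`, every tuple has member size `≤ ρ + r` and context
`‖H′ − 1‖ ≤ e^{ρ+r} − 1`. [folklore] -/
theorem sizes_on_ball {p₀ p : (ι → 𝔸) × (ι → 𝔸) × (ι → 𝔸) × (ι → 𝔸) × 𝔸} {ρ r : ℝ} (hr : 0 ≤ r)
    (ha : ∀ i, ‖p₀.1 i‖ ≤ ρ) (hb : ∀ i, ‖p₀.2.1 i‖ ≤ ρ) (hc : ∀ i, ‖p₀.2.2.1 i‖ ≤ ρ) (hd : ∀ i, ‖p₀.2.2.2.1 i‖ ≤ ρ)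
    (hH : ‖p₀.2.2.2.2 - 1‖ ≤ Real.exp ρ - 1) (hp : p ∈ ball p₀ r) :
    (∀ i, ‖p.1 i‖ ≤ ρ + r) ∧ (∀ i, ‖p.2.1 i‖ ≤ ρ + r) ∧ (∀ i, ‖p.2.2.1 i‖ ≤ ρ + r) ∧ (∀ i, ‖p.2.2.2.1 i‖ ≤ ρ + r) ∧
      ‖p.2.2.2.2 - 1‖ ≤ Real.exp (ρ + r) - 1 := by
  have hpr : ‖p - p₀‖ < r := by rwa [mem_ball, dist_eq_norm] at hp
  have h1 : ‖p.1 - p₀.1‖ ≤ ‖p - p₀‖ := norm_fst_le (p - p₀)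
  have h2 : ‖p.2 - p₀.2‖ ≤ ‖p - p₀‖ := norm_snd_le (p - p₀)
  have h21 : ‖p.2.1 - p₀.2.1‖ ≤ ‖p - p₀‖ := (norm_fst_le (p.2 - p₀.2)).trans h2
  have h22 : ‖p.2.2 - p₀.2.2‖ ≤ ‖p - p₀‖ := (norm_snd_le (p.2 - p₀.2)).trans h2
  have h221 : ‖p.2.2.1 - p₀.2.2.1‖ ≤ ‖p - p₀‖ := (norm_fst_le (p.2.2 - p₀.2.2)).trans h22
  have h222 : ‖p.2.2.2 - p₀.2.2.2‖ ≤ ‖p - p₀‖ := (norm_snd_le (p.2.2 - p₀.2.2)).trans h22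
  have h2221 : ‖p.2.2.2.1 - p₀.2.2.2.1‖ ≤ ‖p - p₀‖ := (norm_fst_le (p.2.2.2 - p₀.2.2.2)).trans h222
  have h2222 : ‖p.2.2.2.2 - p₀.2.2.2.2‖ ≤ ‖p - p₀‖ := (norm_snd_le (p.2.2.2 - p₀.2.2.2)).trans h222
  have slot : ∀ (f g : ι → 𝔸), ‖f - g‖ ≤ ‖p - p₀‖ → (∀ i, ‖g i‖ ≤ ρ) → ∀ i, ‖f i‖ ≤ ρ + r := by
    intro f g hfg hg i
    have hi : ‖f i - g i‖ ≤ ‖f - g‖ := by simpa using norm_le_pi_norm (f - g) i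
    calc ‖f i‖ = ‖g i + (f i - g i)‖ := by rw [add_sub_cancel]
      _ ≤ ‖g i‖ + ‖f i - g i‖ := norm_add_le _ _
      _ ≤ ρ + r := add_le_add (hg i) (by linarith)
  refine ⟨slot _ _ h1 ha, slot _ _ h21 hb, slot _ _ h221 hc, slot _ _ h2221 hd, ?_⟩
  have hexp : Real.exp ρ - 1 + r ≤ Real.exp (ρ + r) - 1 := by
    have hρ0 : 0 ≤ ρ := (norm_nonneg _).trans (ha (Classical.arbitrary ι))
    have h1 : 1 ≤ Real.exp ρ := Real.one_le_exp hρ0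
    have h2 : r ≤ Real.exp r - 1 := by linarith [Real.add_one_le_exp r]
    have h3 : 1 * r ≤ Real.exp ρ * (Real.exp r - 1) := mul_le_mul h1 h2 hr (by linarith)
    rw [Real.exp_add]; nlinarith
  calc ‖p.2.2.2.2 - 1‖ = ‖(p₀.2.2.2.2 - 1) + (p.2.2.2.2 - p₀.2.2.2.2)‖ := by congr 1; abel
    _ ≤ ‖p₀.2.2.2.2 - 1‖ + ‖p.2.2.2.2 - p₀.2.2.2.2‖ := norm_add_le _ _
    _ ≤ (Real.exp ρ - 1) + r := add_le_add hH (by linarith)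
    _ ≤ Real.exp (ρ + r) - 1 := hexp

omit [NormOneClass 𝔸] in
/-- ★ **THE HYBRID ×4 MAP IS COMPLEX-DIFFERENTIABLE ON THE SMALL BALL** (`ρ + r ≤ 1∕100`): compositions of `exp` (entire), the uniform means (linear), products (bilinear) and
`log` INSIDE its ball of analyticity (`norm_word4_sub_one_lt_one`, lit ✓`analyticAt_mlog`). [cite: Balaban1985Averaging, (21) p.21] -/
theorem differentiableOn_hybrid4 {p₀ : (ι → 𝔸) × (ι → 𝔸) × (ι → 𝔸) × (ι → 𝔸) × 𝔸} {ρ r : ℝ} (hr : 0 ≤ r) (hρr : ρ + r ≤ 1 / 100)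
    (ha : ∀ i, ‖p₀.1 i‖ ≤ ρ) (hb : ∀ i, ‖p₀.2.1 i‖ ≤ ρ) (hc : ∀ i, ‖p₀.2.2.1 i‖ ≤ ρ) (hd : ∀ i, ‖p₀.2.2.2.1 i‖ ≤ ρ)
    (hH : ‖p₀.2.2.2.2 - 1‖ ≤ Real.exp ρ - 1) :
    DifferentiableOn ℂ (fun p : (ι → 𝔸) × (ι → 𝔸) × (ι → 𝔸) × (ι → 𝔸) × 𝔸 =>
      mlog (exp (((Fintype.card ι : ℝ))⁻¹ • ∑ i, p.1 i) * exp (((Fintype.card ι : ℝ))⁻¹ • ∑ i, p.2.1 i) *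
          exp (((Fintype.card ι : ℝ))⁻¹ • ∑ i, p.2.2.1 i) * exp (((Fintype.card ι : ℝ))⁻¹ • ∑ i, p.2.2.2.1 i) * p.2.2.2.2) -
        ((Fintype.card ι : ℝ))⁻¹ • ∑ i, ((Fintype.card ι : ℝ))⁻¹ • ∑ j, ((Fintype.card ι : ℝ))⁻¹ • ∑ k, ((Fintype.card ι : ℝ))⁻¹ • ∑ l,
          mlog (exp (p.1 i) * exp (p.2.1 j) * exp (p.2.2.1 k) * exp (p.2.2.2.1 l) * p.2.2.2.2)) (ball p₀ r) := by
  intro p hp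
  obtain ⟨ha', hb', hc', hd', hH'⟩ := sizes_on_ball hr ha hb hc hd hH hp
  have hρ' : ρ + r ≤ 1 / 100 := hρr
  have hexp : Differentiable ℂ (exp : 𝔸 → 𝔸) := differentiable_exp
  -- coordinate maps
  have hA : ∀ i, Differentiable ℂ (fun p : (ι → 𝔸) × (ι → 𝔸) × (ι → 𝔸) × (ι → 𝔸) × 𝔸 => p.1 i) := fun i => by fun_prop
  have hB : ∀ i, Differentiable ℂ (fun p : (ι → 𝔸) × (ι → 𝔸) × (ι → 𝔸) × (ι → 𝔸) × 𝔸 => p.2.1 i) := fun i => by fun_prop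
  have hC : ∀ i, Differentiable ℂ (fun p : (ι → 𝔸) × (ι → 𝔸) × (ι → 𝔸) × (ι → 𝔸) × 𝔸 => p.2.2.1 i) := fun i => by fun_prop
  have hD : ∀ i, Differentiable ℂ (fun p : (ι → 𝔸) × (ι → 𝔸) × (ι → 𝔸) × (ι → 𝔸) × 𝔸 => p.2.2.2.1 i) := fun i => by fun_prop
  have hHd : Differentiable ℂ (fun p : (ι → 𝔸) × (ι → 𝔸) × (ι → 𝔸) × (ι → 𝔸) × 𝔸 => p.2.2.2.2) := by fun_prop
  -- means are differentiable (real scalar, finite sums)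
  have hmean : ∀ (f : ι → ((ι → 𝔸) × (ι → 𝔸) × (ι → 𝔸) × (ι → 𝔸) × 𝔸) → 𝔸), (∀ i, Differentiable ℂ (f i)) →
      Differentiable ℂ (fun p => ((Fintype.card ι : ℝ))⁻¹ • ∑ i, f i p) := fun f hf => by
    have hs : Differentiable ℂ (fun p => ∑ i, f i p) := Differentiable.fun_sum fun i _ => hf i
    exact hs.const_smul _
  -- the central word and the member words are differentiable everywhere
  have hW : Differentiable ℂ (fun p : (ι → 𝔸) × (ι → 𝔸) × (ι → 𝔸) × (ι → 𝔸) × 𝔸 =>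
      exp (((Fintype.card ι : ℝ))⁻¹ • ∑ i, p.1 i) * exp (((Fintype.card ι : ℝ))⁻¹ • ∑ i, p.2.1 i) *
        exp (((Fintype.card ι : ℝ))⁻¹ • ∑ i, p.2.2.1 i) * exp (((Fintype.card ι : ℝ))⁻¹ • ∑ i, p.2.2.2.1 i) * p.2.2.2.2) :=
    ((((hexp.comp (hmean _ hA)).mul (hexp.comp (hmean _ hB))).mul (hexp.comp (hmean _ hC))).mul (hexp.comp (hmean _ hD))).mul hHd
  have hw : ∀ i j k l, Differentiable ℂ (fun p : (ι → 𝔸) × (ι → 𝔸) × (ι → 𝔸) × (ι → 𝔸) × 𝔸 =>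
      exp (p.1 i) * exp (p.2.1 j) * exp (p.2.2.1 k) * exp (p.2.2.2.1 l) * p.2.2.2.2) := fun i j k l =>
    ((((hexp.comp (hA i)).mul (hexp.comp (hB j))).mul (hexp.comp (hC k))).mul (hexp.comp (hD l))).mul hHd
  -- `log` is analytic at each word (inside its ball)
  have hlogW : DifferentiableAt ℂ (fun p : (ι → 𝔸) × (ι → 𝔸) × (ι → 𝔸) × (ι → 𝔸) × 𝔸 =>
      mlog (exp (((Fintype.card ι : ℝ))⁻¹ • ∑ i, p.1 i) * exp (((Fintype.card ι : ℝ))⁻¹ • ∑ i, p.2.1 i) *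
        exp (((Fintype.card ι : ℝ))⁻¹ • ∑ i, p.2.2.1 i) * exp (((Fintype.card ι : ℝ))⁻¹ • ∑ i, p.2.2.2.1 i) * p.2.2.2.2)) p := by
    have hin := norm_word4_sub_one_lt_one hρ' (norm_mean_le _ ha') (norm_mean_le _ hb') (norm_mean_le _ hc') (norm_mean_le _ hd') hH'
    show DifferentiableAt ℂ ((mlog : 𝔸 → 𝔸) ∘ fun p : (ι → 𝔸) × (ι → 𝔸) × (ι → 𝔸) × (ι → 𝔸) × 𝔸 =>
      exp (((Fintype.card ι : ℝ))⁻¹ • ∑ i, p.1 i) * exp (((Fintype.card ι : ℝ))⁻¹ • ∑ i, p.2.1 i) *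
        exp (((Fintype.card ι : ℝ))⁻¹ • ∑ i, p.2.2.1 i) * exp (((Fintype.card ι : ℝ))⁻¹ • ∑ i, p.2.2.2.1 i) * p.2.2.2.2) p
    exact (analyticAt_mlog hin).differentiableAt.comp p (hW p)
  have hlogw : ∀ i j k l, DifferentiableAt ℂ (fun p : (ι → 𝔸) × (ι → 𝔸) × (ι → 𝔸) × (ι → 𝔸) × 𝔸 =>
      mlog (exp (p.1 i) * exp (p.2.1 j) * exp (p.2.2.1 k) * exp (p.2.2.2.1 l) * p.2.2.2.2)) p := fun i j k l => by
    have hin := norm_word4_sub_one_lt_one hρ' (ha' i) (hb' j) (hc' k) (hd' l) hH'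
    show DifferentiableAt ℂ ((mlog : 𝔸 → 𝔸) ∘ fun p : (ι → 𝔸) × (ι → 𝔸) × (ι → 𝔸) × (ι → 𝔸) × 𝔸 =>
      exp (p.1 i) * exp (p.2.1 j) * exp (p.2.2.1 k) * exp (p.2.2.2.1 l) * p.2.2.2.2) p
    exact (analyticAt_mlog hin).differentiableAt.comp p (hw i j k l p)
  have hM4 : DifferentiableAt ℂ (fun p : (ι → 𝔸) × (ι → 𝔸) × (ι → 𝔸) × (ι → 𝔸) × 𝔸 =>
      ((Fintype.card ι : ℝ))⁻¹ • ∑ i, ((Fintype.card ι : ℝ))⁻¹ • ∑ j, ((Fintype.card ι : ℝ))⁻¹ • ∑ k, ((Fintype.card ι : ℝ))⁻¹ • ∑ l,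
        mlog (exp (p.1 i) * exp (p.2.1 j) * exp (p.2.2.1 k) * exp (p.2.2.2.1 l) * p.2.2.2.2)) p := by
    refine (DifferentiableAt.fun_sum fun i _ => ?_).const_smul _
    refine (DifferentiableAt.fun_sum fun j _ => ?_).const_smul _
    refine (DifferentiableAt.fun_sum fun k _ => ?_).const_smul _
    refine (DifferentiableAt.fun_sum fun l _ => ?_).const_smul _
    exact hlogw i j k l
  exact (hlogW.sub hM4).differentiableWithinAt

/-! ## §3 The relative hybrid ×4 letter -/

omit [NormedAlgebra ℂ 𝔸] [CompleteSpace 𝔸] [NormOneClass 𝔸] in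
/-- On the sup-ball of radius `R` about the IDENTITY tuple `(0,0,0,0,1)` every tuple has member size `< R` and context `‖H − 1‖ < R ≤ e^{R} − 1`. [folklore] -/
theorem sizes_on_ball_one {p : (ι → 𝔸) × (ι → 𝔸) × (ι → 𝔸) × (ι → 𝔸) × 𝔸} {R : ℝ}
    (hp : p ∈ ball ((0, 0, 0, 0, 1) : (ι → 𝔸) × (ι → 𝔸) × (ι → 𝔸) × (ι → 𝔸) × 𝔸) R) :
    (∀ i, ‖p.1 i‖ ≤ R) ∧ (∀ i, ‖p.2.1 i‖ ≤ R) ∧ (∀ i, ‖p.2.2.1 i‖ ≤ R) ∧ (∀ i, ‖p.2.2.2.1 i‖ ≤ R) ∧ ‖p.2.2.2.2 - 1‖ ≤ Real.exp R - 1 := by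
  have h0 : ∀ i, ‖(0 : ι → 𝔸) i‖ ≤ 0 := fun i => by simp
  obtain ⟨ha, hb, hc, hd, hH⟩ := sizes_on_ball (p₀ := ((0, 0, 0, 0, 1) : (ι → 𝔸) × (ι → 𝔸) × (ι → 𝔸) × (ι → 𝔸) × 𝔸)) (r := R)
    (ρ := 0) ((nonempty_ball.mp ⟨p, hp⟩).le) h0 h0 h0 h0 (by simp) hp
  simp only [zero_add] at ha hb hc hd hH
  exact ⟨ha, hb, hc, hd, hH⟩

omit [NormedAlgebra ℂ 𝔸] [CompleteSpace 𝔸] [NormOneClass 𝔸] [Nonempty ι] in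
/-- A tuple of member size `≤ ρ` with context `‖H − 1‖ ≤ e^ρ − 1`, `0 < ρ ≤ 1`, lies in the sup-ball of radius `2ρ` about the identity tuple. [folklore] -/
theorem mem_ball_one_of_sizes {p : (ι → 𝔸) × (ι → 𝔸) × (ι → 𝔸) × (ι → 𝔸) × 𝔸} {ρ : ℝ} (hρ0 : 0 < ρ) (hρ1 : ρ ≤ 1)
    (ha : ∀ i, ‖p.1 i‖ ≤ ρ) (hb : ∀ i, ‖p.2.1 i‖ ≤ ρ) (hc : ∀ i, ‖p.2.2.1 i‖ ≤ ρ) (hd : ∀ i, ‖p.2.2.2.1 i‖ ≤ ρ)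
    (hH : ‖p.2.2.2.2 - 1‖ ≤ Real.exp ρ - 1) :
    p ∈ ball ((0, 0, 0, 0, 1) : (ι → 𝔸) × (ι → 𝔸) × (ι → 𝔸) × (ι → 𝔸) × 𝔸) (2 * ρ) := by
  have hpi : ∀ (f : ι → 𝔸), (∀ i, ‖f i‖ ≤ ρ) → ‖f‖ < 2 * ρ := fun f hf =>
    lt_of_le_of_lt ((pi_norm_le_iff_of_nonneg hρ0.le).mpr hf) (by linarith)
  have hexp : Real.exp ρ - 1 < 2 * ρ := by
    have h := Real.exp_bound' (x := ρ) hρ0.le hρ1 (n := 2) (by norm_num)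
    simp only [Finset.sum_range_succ, Finset.sum_range_zero, Nat.factorial, Nat.cast_ofNat] at h
    nlinarith
  rw [mem_ball, dist_eq_norm]
  simp only [Prod.norm_def, Prod.fst_sub, Prod.snd_sub, sub_zero, max_lt_iff]
  exact ⟨hpi _ ha, hpi _ hb, hpi _ hc, hpi _ hd, hH.trans_lt hexp⟩

/-- ★★★ **THE RELATIVE HYBRID ×4 LETTER** (✓G10's `O(size)`-Lipschitz edition, by Cauchy): two member tuples `a,b,c,d` and `a′,b′,c′,d′ : ι → 𝔸` of size `≤ ρ`, contexts
`‖H − 1‖, ‖H′ − 1‖ ≤ e^ρ − 1`, `0 < ρ ≤ 1∕800`, and ANY `δ` dominating the sup of the differences (`‖a′ i − a i‖ ≤ δ` for all members and slots, `‖H′ − H‖ ≤ δ`).  Then the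
hybrid junk `J₁₀ := log(e^{ā}e^{b̄}e^{c̄}e^{d̄}H) − mean⁴ log(e^{a i}e^{b j}e^{c k}e^{d l}H)` of ✓G10 moves by at most
`‖J₁₀(a′,b′,c′,d′,H′) − J₁₀(a,b,c,d,H)‖ ≤ 4096·(e^{32ρ} − 1)·δ` — Lipschitz constant = THE SIZE (`≈ 1.3·10⁵·ρ`); NO closeness of the two tuples is required, and the junk
VANISHES when they agree (proof: both tuples lie in the sup-ball of radius `2ρ` about the identity tuple; ✓G10 bounds `J₁₀` by `M = 128(e^{32ρ} − 1)·64ρ` on the ball of radius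
`8ρ`; `norm_sub_le_on_half_ball`). [cite: Balaban1985Averaging, (21) p.21] -/
theorem norm_hybrid4_sub_hybrid4_le (a b c d a' b' c' d' : ι → 𝔸) (H H' : 𝔸) {ρ δ : ℝ} (hρ0 : 0 < ρ) (hρ : ρ ≤ 1 / 800)
    (ha : ∀ i, ‖a i‖ ≤ ρ) (hb : ∀ i, ‖b i‖ ≤ ρ) (hc : ∀ i, ‖c i‖ ≤ ρ) (hd : ∀ i, ‖d i‖ ≤ ρ) (hH : ‖H - 1‖ ≤ Real.exp ρ - 1)
    (ha' : ∀ i, ‖a' i‖ ≤ ρ) (hb' : ∀ i, ‖b' i‖ ≤ ρ) (hc' : ∀ i, ‖c' i‖ ≤ ρ) (hd' : ∀ i, ‖d' i‖ ≤ ρ) (hH' : ‖H' - 1‖ ≤ Real.exp ρ - 1)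
    (hδ0 : 0 ≤ δ) (hda : ∀ i, ‖a' i - a i‖ ≤ δ) (hdb : ∀ i, ‖b' i - b i‖ ≤ δ) (hdc : ∀ i, ‖c' i - c i‖ ≤ δ) (hdd : ∀ i, ‖d' i - d i‖ ≤ δ)
    (hdH : ‖H' - H‖ ≤ δ) :
    ‖(mlog (exp (((Fintype.card ι : ℝ))⁻¹ • ∑ i, a' i) * exp (((Fintype.card ι : ℝ))⁻¹ • ∑ i, b' i) *
          exp (((Fintype.card ι : ℝ))⁻¹ • ∑ i, c' i) * exp (((Fintype.card ι : ℝ))⁻¹ • ∑ i, d' i) * H') -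
        ((Fintype.card ι : ℝ))⁻¹ • ∑ i, ((Fintype.card ι : ℝ))⁻¹ • ∑ j, ((Fintype.card ι : ℝ))⁻¹ • ∑ k, ((Fintype.card ι : ℝ))⁻¹ • ∑ l,
          mlog (exp (a' i) * exp (b' j) * exp (c' k) * exp (d' l) * H')) -
      (mlog (exp (((Fintype.card ι : ℝ))⁻¹ • ∑ i, a i) * exp (((Fintype.card ι : ℝ))⁻¹ • ∑ i, b i) *
          exp (((Fintype.card ι : ℝ))⁻¹ • ∑ i, c i) * exp (((Fintype.card ι : ℝ))⁻¹ • ∑ i, d i) * H) -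
        ((Fintype.card ι : ℝ))⁻¹ • ∑ i, ((Fintype.card ι : ℝ))⁻¹ • ∑ j, ((Fintype.card ι : ℝ))⁻¹ • ∑ k, ((Fintype.card ι : ℝ))⁻¹ • ∑ l,
          mlog (exp (a i) * exp (b j) * exp (c k) * exp (d l) * H))‖ ≤
      4096 * (Real.exp (32 * ρ) - 1) * δ := by
  -- the map on `E = (ι → 𝔸)⁴ × 𝔸`
  set J : ((ι → 𝔸) × (ι → 𝔸) × (ι → 𝔸) × (ι → 𝔸) × 𝔸) → 𝔸 := fun p =>
      mlog (exp (((Fintype.card ι : ℝ))⁻¹ • ∑ i, p.1 i) * exp (((Fintype.card ι : ℝ))⁻¹ • ∑ i, p.2.1 i) *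
          exp (((Fintype.card ι : ℝ))⁻¹ • ∑ i, p.2.2.1 i) * exp (((Fintype.card ι : ℝ))⁻¹ • ∑ i, p.2.2.2.1 i) * p.2.2.2.2) -
        ((Fintype.card ι : ℝ))⁻¹ • ∑ i, ((Fintype.card ι : ℝ))⁻¹ • ∑ j, ((Fintype.card ι : ℝ))⁻¹ • ∑ k, ((Fintype.card ι : ℝ))⁻¹ • ∑ l,
          mlog (exp (p.1 i) * exp (p.2.1 j) * exp (p.2.2.1 k) * exp (p.2.2.2.1 l) * p.2.2.2.2) with hJ
  have hρ1 : ρ ≤ 1 := by linarith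
  -- both tuples in the half ball (radius `4ρ`) of the ball of radius `8ρ` about the identity tuple
  have hp₀ball : ((a, b, c, d, H) : (ι → 𝔸) × (ι → 𝔸) × (ι → 𝔸) × (ι → 𝔸) × 𝔸) ∈
      ball ((0, 0, 0, 0, 1) : (ι → 𝔸) × (ι → 𝔸) × (ι → 𝔸) × (ι → 𝔸) × 𝔸) (8 * ρ / 2) := by
    have h := mem_ball_one_of_sizes (p := ((a, b, c, d, H) : (ι → 𝔸) × (ι → 𝔸) × (ι → 𝔸) × (ι → 𝔸) × 𝔸)) hρ0 hρ1 ha hb hc hd hH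
    rw [mem_ball] at h ⊢; linarith
  have hp₁ball : ((a', b', c', d', H') : (ι → 𝔸) × (ι → 𝔸) × (ι → 𝔸) × (ι → 𝔸) × 𝔸) ∈
      ball ((0, 0, 0, 0, 1) : (ι → 𝔸) × (ι → 𝔸) × (ι → 𝔸) × (ι → 𝔸) × 𝔸) (8 * ρ / 2) := by
    have h := mem_ball_one_of_sizes (p := ((a', b', c', d', H') : (ι → 𝔸) × (ι → 𝔸) × (ι → 𝔸) × (ι → 𝔸) × 𝔸)) hρ0 hρ1 ha' hb' hc' hd' hH'
    rw [mem_ball] at h ⊢; linarith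
  -- differentiability on the big ball (sizes `≤ 8ρ ≤ 1∕100` there)
  have h0 : ∀ i, ‖(0 : ι → 𝔸) i‖ ≤ 0 := fun i => by simp
  have hdiff : DifferentiableOn ℂ J (ball ((0, 0, 0, 0, 1) : (ι → 𝔸) × (ι → 𝔸) × (ι → 𝔸) × (ι → 𝔸) × 𝔸) (8 * ρ)) :=
    differentiableOn_hybrid4 (p₀ := ((0, 0, 0, 0, 1) : (ι → 𝔸) × (ι → 𝔸) × (ι → 𝔸) × (ι → 𝔸) × 𝔸)) (ρ := 0) (r := 8 * ρ)
      (by linarith) (by linarith) h0 h0 h0 h0 (by simp)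
  -- the absolute bound on the big ball: ✓G10 at radius `8ρ` with fluctuations `≤ 16ρ` per slot
  have hM : ∀ p ∈ ball ((0, 0, 0, 0, 1) : (ι → 𝔸) × (ι → 𝔸) × (ι → 𝔸) × (ι → 𝔸) × 𝔸) (8 * ρ),
      ‖J p‖ ≤ 64 * (2 * (Real.exp (4 * (8 * ρ)) - 1)) * (64 * ρ) := by
    intro p hp
    obtain ⟨ha₈, hb₈, hc₈, hd₈, hH₈⟩ := sizes_on_ball_one hp
    have hG := norm_mlog_word4_sub_mean4_le p.1 p.2.1 p.2.2.1 p.2.2.2.1 p.2.2.2.2 (ρ := 8 * ρ) (by linarith) ha₈ hb₈ hc₈ hd₈ hH₈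
    refine hG.trans (mul_le_mul_of_nonneg_left ?_ (by
      have : 0 ≤ Real.exp (4 * (8 * ρ)) - 1 := by linarith [Real.add_one_le_exp (4 * (8 * ρ))]
      positivity))
    -- each slot's fluctuation is `≤ 2·(8ρ)`
    have fl : ∀ (f : ι → 𝔸), (∀ i, ‖f i‖ ≤ 8 * ρ) → ((Fintype.card ι : ℝ))⁻¹ * ∑ i, ‖f i - ((Fintype.card ι : ℝ))⁻¹ • ∑ j, f j‖ ≤ 16 * ρ := by
      intro f hf
      have hc0 : (0 : ℝ) < Fintype.card ι := Nat.cast_pos.mpr Fintype.card_pos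
      have hterm : ∀ i, ‖f i - ((Fintype.card ι : ℝ))⁻¹ • ∑ j, f j‖ ≤ 16 * ρ := fun i =>
        (norm_sub_le _ _).trans (by linarith [hf i, norm_mean_le f hf])
      calc ((Fintype.card ι : ℝ))⁻¹ * ∑ i, ‖f i - ((Fintype.card ι : ℝ))⁻¹ • ∑ j, f j‖ ≤ ((Fintype.card ι : ℝ))⁻¹ * ∑ _i : ι, 16 * ρ :=
          mul_le_mul_of_nonneg_left (Finset.sum_le_sum fun i _ => hterm i) (inv_nonneg.mpr hc0.le)
        _ = 16 * ρ := by rw [Finset.sum_const, Finset.card_univ, nsmul_eq_mul, ← mul_assoc, inv_mul_cancel₀ hc0.ne', one_mul]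
    linarith [fl p.1 ha₈, fl p.2.1 hb₈, fl p.2.2.1 hc₈, fl p.2.2.2.1 hd₈]
  -- the two-point device
  have key := norm_sub_le_on_half_ball hdiff hM hp₁ball hp₀ball
  have hdist : ‖((a', b', c', d', H') : (ι → 𝔸) × (ι → 𝔸) × (ι → 𝔸) × (ι → 𝔸) × 𝔸) - (a, b, c, d, H)‖ ≤ δ := by
    have hpi : ∀ (f g : ι → 𝔸), (∀ i, ‖f i - g i‖ ≤ δ) → ‖f - g‖ ≤ δ := fun f g h =>
      (pi_norm_le_iff_of_nonneg hδ0).mpr fun i => by simpa using h i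
    simp only [Prod.mk_sub_mk, Prod.norm_def, max_le_iff]
    exact ⟨hpi _ _ hda, hpi _ _ hdb, hpi _ _ hdc, hpi _ _ hdd, hdH⟩
  have hE0 : 0 ≤ Real.exp (32 * ρ) - 1 := by linarith [Real.add_one_le_exp (32 * ρ)]
  have hcoef : 4 * (64 * (2 * (Real.exp (4 * (8 * ρ)) - 1)) * (64 * ρ)) / (8 * ρ) = 4096 * (Real.exp (32 * ρ) - 1) := by
    rw [show 4 * (8 * ρ) = 32 * ρ by ring]
    field_simp
    ring
  rw [hcoef] at key
  have hJ1 : J (a', b', c', d', H') = mlog (exp (((Fintype.card ι : ℝ))⁻¹ • ∑ i, a' i) * exp (((Fintype.card ι : ℝ))⁻¹ • ∑ i, b' i) *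
          exp (((Fintype.card ι : ℝ))⁻¹ • ∑ i, c' i) * exp (((Fintype.card ι : ℝ))⁻¹ • ∑ i, d' i) * H') -
        ((Fintype.card ι : ℝ))⁻¹ • ∑ i, ((Fintype.card ι : ℝ))⁻¹ • ∑ j, ((Fintype.card ι : ℝ))⁻¹ • ∑ k, ((Fintype.card ι : ℝ))⁻¹ • ∑ l,
          mlog (exp (a' i) * exp (b' j) * exp (c' k) * exp (d' l) * H') := rfl
  have hJ0 : J (a, b, c, d, H) = mlog (exp (((Fintype.card ι : ℝ))⁻¹ • ∑ i, a i) * exp (((Fintype.card ι : ℝ))⁻¹ • ∑ i, b i) *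
          exp (((Fintype.card ι : ℝ))⁻¹ • ∑ i, c i) * exp (((Fintype.card ι : ℝ))⁻¹ • ∑ i, d i) * H) -
        ((Fintype.card ι : ℝ))⁻¹ • ∑ i, ((Fintype.card ι : ℝ))⁻¹ • ∑ j, ((Fintype.card ι : ℝ))⁻¹ • ∑ k, ((Fintype.card ι : ℝ))⁻¹ • ∑ l,
          mlog (exp (a i) * exp (b j) * exp (c k) * exp (d l) * H) := rfl
  rw [← hJ1, ← hJ0]
  exact key.trans (mul_le_mul_of_nonneg_left hdist (mul_nonneg (by norm_num) hE0))

end Hybrid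

end Summit.QuantumFields.YangMills.Theorems.FluctuationComparisonRegPrIntLS2BetaSizeLipschitzByCauchy

end
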